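import Literature.RingTheory.FormalGroups.FormalOModuleBudVariation
import Mathlib.Data.Nat.Choose.Sum
import HarnessLib

/-!
# Buds of formal `𝒪`-module laws, IV: the degree-`m` coefficients of the variations
# ([Lazard 1955] §II Lemme 2–3; [Drinfeld 1974] §1; [Hazewinkel 1978] §5.7)

Topic `Literature/RingTheory/FormalGroups`; namespace `Literature.RingTheory.FormalGroups`.  One plumbing definition
(`degCoeff m Γ j`, the coefficient of `X₀^j X₁^{m−j}`) + fully proved theorems; no named fact, no instance, no notation, no
`sorry`.  Cell `hodgecm-mathlib`, P6 «MOD programme», sub-line P6d (power-series layer for `stub_L4B3cO`).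

For a perturbation `Γ` of order `≥ m` (resp. `θ` of order `≥ m`) only the degree-`m` part matters modulo degree `m + 1`, and the
linear variations of the sibling `FormalOModuleBudVariation` are evaluated at LINEAR arguments.  Hence their degree-`m`
coefficients are explicit (Lazard's computation):
* `coeff_subst_eq_sum_of_le_order` — `[X^d] Γ(a) = Σ_j γ_j · [X^d](a₀^j a₁^{m−j})` (`|d| = m`, `γ_j = [X₀^jX₁^{m−j}]Γ`);
  `coeff_psubst_eq_of_le_order` — `[X^d] θ(u) = θ_m · [X^d] u^m`.
* coefficients of monomials in linear arguments: `Y₀^aY₁^bY₂^c`, `(Y₀+Y₁)^n Y₂^l`, `Y₀^n (Y₁+Y₂)^l`, `X₀^aX₁^b`, `(X₀+X₁)^n`.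

Deliberately NOT here: the coefficients of the variations themselves (sibling `FormalOModuleBudCoeffVar`) and the
identification with Lazard ∕ Drinfeld cocycles (sibling `FormalOModuleBudCocycle`).
-/

noncomputable section

namespace Literature.RingTheory.FormalGroups

open MvPowerSeries (HasSubst subst X order coeff monomial)
open Finset Finsupp

universe v

variable {B : Type v} [CommRing B]

/-! ## §1 The degree-`m` coefficients of a two-variable series -/

/-- `degCoeff m Γ j` = the coefficient of `X₀^j X₁^{m−j}` in `Γ` for `j ≤ m`, and `0` for `j > m`. [cite: Lazard1955, §II Lemme 2] -/
def degCoeff (m : ℕ) (Γ : MvPowerSeries (Fin 2) B) (j : ℕ) : B :=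
  if j ≤ m then coeff (single 0 j + single 1 (m - j)) Γ else 0

/-- `degCoeff m Γ j = [X₀^jX₁^{m−j}] Γ` for `j ≤ m`. [cite: Lazard1955, §II Lemme 2] -/
theorem degCoeff_of_le {m j : ℕ} (Γ : MvPowerSeries (Fin 2) B) (h : j ≤ m) :
    degCoeff m Γ j = coeff (single 0 j + single 1 (m - j)) Γ := if_pos h

/-- `degCoeff m Γ j = 0` for `j > m`. [cite: Lazard1955, §II Lemme 2] -/
theorem degCoeff_of_lt {m j : ℕ} (Γ : MvPowerSeries (Fin 2) B) (h : m < j) : degCoeff m Γ j = 0 := if_neg (by omega)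

/-- `degCoeff` is additive. [cite: Lazard1955, §II Lemme 2] -/
theorem degCoeff_add (m : ℕ) (Γ Γ' : MvPowerSeries (Fin 2) B) (j : ℕ) :
    degCoeff m (Γ + Γ') j = degCoeff m Γ j + degCoeff m Γ' j := by
  by_cases h : j ≤ m <;> simp [degCoeff, h]

/-- `degCoeff` of a scalar multiple. [cite: Lazard1955, §II Lemme 2] -/
theorem degCoeff_smul (m : ℕ) (c : B) (Γ : MvPowerSeries (Fin 2) B) (j : ℕ) :
    degCoeff m (c • Γ) j = c * degCoeff m Γ j := by
  by_cases h : j ≤ m <;> simp [degCoeff, h]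

/-- `degCoeff` commutes with base change. [cite: Lazard1955, §II Lemme 2] -/
theorem degCoeff_map {B' : Type*} [CommRing B'] (f : B →+* B') (m : ℕ) (Γ : MvPowerSeries (Fin 2) B) (j : ℕ) :
    degCoeff m (MvPowerSeries.map f Γ) j = f (degCoeff m Γ j) := by
  by_cases h : j ≤ m <;> simp [degCoeff, h]

/-- A two-variable exponent of degree `m` is `(j, m−j)` with `j = d 0`. [folklore] -/
private theorem fin_two_eq_of_degree {d : Fin 2 →₀ ℕ} {m : ℕ} (hd : d.degree = m) :
    d = single 0 (d 0) + single 1 (m - d 0) ∧ d 0 ≤ m := by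
  rw [degree_eq_sum, Fin.sum_univ_two] at hd
  refine ⟨Finsupp.ext fun i => ?_, by omega⟩
  fin_cases i
  · simp
  · simp; omega

/-- The order of a product of powers of two series without constant term. [cite: Lazard1955, §I Lemme 1] -/
private theorem le_order_pow_mul_pow {τ : Type*} {u v : MvPowerSeries τ B} (hu : MvPowerSeries.constantCoeff u = 0)
    (hv : MvPowerSeries.constantCoeff v = 0) (a b : ℕ) : ((a + b : ℕ) : ℕ∞) ≤ (u ^ a * v ^ b).order :=
  natCast_add_le_order_mul (natCast_le_order_pow hu a) (natCast_le_order_pow hv b)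

/-- **Degree-`m` coefficients of `Γ(a₀,a₁)`** for `Γ` of order `≥ m` and arguments without constant term:
`[X^d] Γ(a) = Σ_{j ≤ m} γ_j · [X^d](a₀^j · a₁^{m−j})` for `|d| = m` — only the degree-`m` part of `Γ` contributes.
[cite: Lazard1955, §II Lemme 2] -/
theorem coeff_subst_eq_sum_of_le_order {τ : Type*} {m : ℕ} {Γ : MvPowerSeries (Fin 2) B} (hΓ : (m : ℕ∞) ≤ Γ.order)
    {a : Fin 2 → MvPowerSeries τ B} (ha : ∀ i, MvPowerSeries.constantCoeff (a i) = 0) {d : τ →₀ ℕ}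
    (hd : d.degree = m) :
    coeff d (Γ.subst a) = ∑ j ∈ range (m + 1), degCoeff m Γ j * coeff d (a 0 ^ j * a 1 ^ (m - j)) := by
  classical
  have has := MvPowerSeries.hasSubst_of_constantCoeff_zero ha
  rw [MvPowerSeries.coeff_subst has]
  set S : Finset (Fin 2 →₀ ℕ) := (range (m + 1)).image fun j => single 0 j + single 1 (m - j) with hS
  have hprod : ∀ e : Fin 2 →₀ ℕ, (e.prod fun s n => a s ^ n) = a 0 ^ e 0 * a 1 ^ e 1 := fun e => by
    rw [Finsupp.prod_pow, Fin.prod_univ_two]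
  have hsupp : (Function.support fun e : Fin 2 →₀ ℕ => coeff e Γ • coeff d (e.prod fun s n => a s ^ n)) ⊆ S := by
    intro e he
    rw [Function.mem_support] at he
    simp only [hS, Finset.coe_image, Set.mem_image, Finset.mem_coe, Finset.mem_range]
    by_contra hne
    apply he
    rcases Nat.lt_trichotomy e.degree m with hlt | heq | hgt
    · rw [MvPowerSeries.coeff_of_lt_order (lt_of_lt_of_le (by exact_mod_cast hlt) hΓ), zero_smul]
    · exact absurd ⟨e 0, by have := fin_two_eq_of_degree heq; omega, (fin_two_eq_of_degree heq).1.symm⟩ hne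
    · have h0 : coeff d (a 0 ^ e 0 * a 1 ^ e 1) = 0 := by
        refine MvPowerSeries.coeff_of_lt_order (lt_of_lt_of_le ?_ (le_order_pow_mul_pow (ha 0) (ha 1) (e 0) (e 1)))
        rw [degree_eq_sum, Fin.sum_univ_two] at hgt
        exact_mod_cast (hd ▸ hgt)
      rw [hprod, h0, smul_zero]
  rw [finsum_eq_sum_of_support_subset _ hsupp, hS, Finset.sum_image]
  · refine Finset.sum_congr rfl fun j hj => ?_
    rw [hprod, degCoeff_of_le Γ (by simpa [Nat.lt_succ_iff] using hj), smul_eq_mul]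
    simp
  · intro j _ j' _ h
    have := DFunLike.congr_fun h 0
    simpa [single_apply] using this

/-- **Degree-`m` coefficients of `θ(u)`** for `θ` of order `≥ m` and `u` without constant term:
`[X^d] θ(u) = θ_m · [X^d] u^m` for `|d| = m`. [cite: Lazard1955, §II Lemme 2] -/
theorem coeff_psubst_eq_of_le_order {τ : Type*} {m : ℕ} {θ : PowerSeries B} (hθ : (m : ℕ∞) ≤ MvPowerSeries.order θ)
    {u : MvPowerSeries τ B} (hu : MvPowerSeries.constantCoeff u = 0) {d : τ →₀ ℕ} (hd : d.degree = m) :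
    coeff d (PowerSeries.subst u θ) = PowerSeries.coeff m θ * coeff d (u ^ m) := by
  classical
  rw [PowerSeries.coeff_subst (PowerSeries.HasSubst.of_constantCoeff_zero hu), finsum_eq_single _ m]
  · rw [smul_eq_mul]
  · intro n hn
    rcases Nat.lt_or_gt_of_ne hn with hlt | hgt
    · have h0 : PowerSeries.coeff n θ = 0 := by
        rw [PowerSeries.coeff_def (s := single () n) (by simp)]
        exact (natCast_le_order_iff.1 hθ) _ (by simpa using hlt)
      rw [h0, zero_smul]
    · rw [MvPowerSeries.coeff_of_lt_order (lt_of_lt_of_le (by exact_mod_cast (hd ▸ hgt)) (natCast_le_order_pow hu n)),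
        smul_zero]

/-! ## §2 Coefficients of monomials in linear arguments -/

section Monomials

/-- Equality of three-variable exponents is componentwise. [folklore] -/
private theorem fin3_single_add_eq_iff {a b c i j k : ℕ} :
    (single (0 : Fin 3) a + single 1 b + single 2 c = single 0 i + single 1 j + single 2 k) ↔ (a = i ∧ b = j ∧ c = k) := by
  constructor
  · intro h
    have h0 := DFunLike.congr_fun h 0
    have h1 := DFunLike.congr_fun h 1
    have h2 := DFunLike.congr_fun h 2
    simp at h0 h1 h2
    exact ⟨h0, h1, h2⟩
  · rintro ⟨rfl, rfl, rfl⟩; rfl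

/-- Equality of two-variable exponents is componentwise. [folklore] -/
private theorem fin2_single_add_eq_iff {a b i j : ℕ} :
    (single (0 : Fin 2) a + single 1 b = single 0 i + single 1 j) ↔ (a = i ∧ b = j) := by
  constructor
  · intro h
    have h0 := DFunLike.congr_fun h 0
    have h1 := DFunLike.congr_fun h 1
    simp at h0 h1
    exact ⟨h0, h1⟩
  · rintro ⟨rfl, rfl⟩; rfl

/-- Coefficients of a three-variable monomial `Y₀^a Y₁^b Y₂^c`. (the coefficient extractions of Lazard's
`B_q`-computations). [cite: Lazard1955, §II Lemme 2] -/
theorem coeff_X_pow_mul_X_pow_mul_X_pow_fin_three (a b c i j k : ℕ) :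
    coeff (single 0 i + single 1 j + single 2 k) ((X 0 : MvPowerSeries (Fin 3) B) ^ a * X 1 ^ b * X 2 ^ c) =
      if a = i ∧ b = j ∧ c = k then 1 else 0 := by
  classical
  rw [MvPowerSeries.X_pow_eq, MvPowerSeries.X_pow_eq, MvPowerSeries.X_pow_eq, MvPowerSeries.monomial_mul_monomial,
    MvPowerSeries.monomial_mul_monomial, one_mul, one_mul, MvPowerSeries.coeff_monomial]
  by_cases h : a = i ∧ b = j ∧ c = k
  · rw [if_pos h, if_pos (fin3_single_add_eq_iff.2 h).symm]
  · rw [if_neg h, if_neg (fun h' => h (fin3_single_add_eq_iff.1 h'.symm))]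

/-- Coefficients of `Y₀^a Y₁^b` in three variables. (the coefficient extractions of Lazard's
`B_q`-computations). [cite: Lazard1955, §II Lemme 2] -/
theorem coeff_X_zero_pow_mul_X_one_pow_fin_three (a b i j k : ℕ) :
    coeff (single 0 i + single 1 j + single 2 k) ((X 0 : MvPowerSeries (Fin 3) B) ^ a * X 1 ^ b) =
      if a = i ∧ b = j ∧ 0 = k then 1 else 0 := by
  rw [← mul_one ((X 0 : MvPowerSeries (Fin 3) B) ^ a * X 1 ^ b), ← pow_zero (X 2 : MvPowerSeries (Fin 3) B)]
  exact coeff_X_pow_mul_X_pow_mul_X_pow_fin_three a b 0 i j k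

/-- Coefficients of `Y₁^a Y₂^b` in three variables. (the coefficient extractions of Lazard's
`B_q`-computations). [cite: Lazard1955, §II Lemme 2] -/
theorem coeff_X_one_pow_mul_X_two_pow_fin_three (a b i j k : ℕ) :
    coeff (single 0 i + single 1 j + single 2 k) ((X 1 : MvPowerSeries (Fin 3) B) ^ a * X 2 ^ b) =
      if 0 = i ∧ a = j ∧ b = k then 1 else 0 := by
  rw [← one_mul ((X 1 : MvPowerSeries (Fin 3) B) ^ a), ← pow_zero (X 0 : MvPowerSeries (Fin 3) B)]
  exact coeff_X_pow_mul_X_pow_mul_X_pow_fin_three 0 a b i j k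

/-- Coefficients of a two-variable monomial `X₀^a X₁^b`. (the coefficient extractions of Lazard's
`B_q`-computations). [cite: Lazard1955, §II Lemme 2] -/
theorem coeff_X_pow_mul_X_pow_fin_two (a b i j : ℕ) :
    coeff (single 0 i + single 1 j) ((X 0 : MvPowerSeries (Fin 2) B) ^ a * X 1 ^ b) = if a = i ∧ b = j then 1 else 0 := by
  classical
  rw [MvPowerSeries.X_pow_eq, MvPowerSeries.X_pow_eq, MvPowerSeries.monomial_mul_monomial, one_mul,
    MvPowerSeries.coeff_monomial]
  by_cases h : a = i ∧ b = j
  · rw [if_pos h, if_pos (fin2_single_add_eq_iff.2 h).symm]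
  · rw [if_neg h, if_neg (fun h' => h (fin2_single_add_eq_iff.1 h'.symm))]

/-- Coefficients of `(Y₀ + Y₁)^n · Y₂^l`: `[Y₀^iY₁^jY₂^k] = C(i+j, i)` if `n = i+j`, `l = k`, else `0`. (the coefficient extractions of Lazard's
`B_q`-computations). [cite: Lazard1955, §II Lemme 2] -/
theorem coeff_add_pow_mul_X_pow_fin_three (n l i j k : ℕ) :
    coeff (single 0 i + single 1 j + single 2 k) (((X 0 : MvPowerSeries (Fin 3) B) + X 1) ^ n * X 2 ^ l) =
      if n = i + j ∧ l = k then ((i + j).choose i : B) else 0 := by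
  rw [(Commute.all (X 0 : MvPowerSeries (Fin 3) B) (X 1)).add_pow', Finset.sum_mul, map_sum]
  simp_rw [smul_mul_assoc, map_nsmul, coeff_X_pow_mul_X_pow_mul_X_pow_fin_three]
  by_cases h : n = i + j ∧ l = k
  · obtain ⟨rfl, rfl⟩ := h
    rw [if_pos ⟨rfl, rfl⟩, Finset.sum_eq_single (i, j)]
    · simp
    · rintro ⟨p, q⟩ hpq hne
      rw [if_neg, smul_zero]
      rintro ⟨rfl, rfl, -⟩
      exact hne rfl
    · intro hmem
      exact (hmem (Finset.mem_antidiagonal.2 rfl)).elim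
  · rw [if_neg h]
    refine Finset.sum_eq_zero fun p hp => ?_
    rw [if_neg, smul_zero]
    rintro ⟨hp1, hp2, hl⟩
    apply h
    rw [Finset.mem_antidiagonal] at hp
    exact ⟨by rw [← hp, hp1, hp2], hl⟩

/-- Coefficients of `Y₀^n · (Y₁ + Y₂)^l`: `[Y₀^iY₁^jY₂^k] = C(j+k, j)` if `n = i`, `l = j+k`, else `0`. (the coefficient extractions of Lazard's
`B_q`-computations). [cite: Lazard1955, §II Lemme 2] -/
theorem coeff_X_pow_mul_add_pow_fin_three (n l i j k : ℕ) :
    coeff (single 0 i + single 1 j + single 2 k) ((X 0 : MvPowerSeries (Fin 3) B) ^ n * (X 1 + X 2) ^ l) =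
      if n = i ∧ l = j + k then ((j + k).choose j : B) else 0 := by
  rw [(Commute.all (X 1 : MvPowerSeries (Fin 3) B) (X 2)).add_pow', Finset.mul_sum, map_sum]
  simp_rw [mul_smul_comm, ← mul_assoc, map_nsmul, coeff_X_pow_mul_X_pow_mul_X_pow_fin_three]
  by_cases h : n = i ∧ l = j + k
  · obtain ⟨rfl, rfl⟩ := h
    rw [if_pos ⟨rfl, rfl⟩, Finset.sum_eq_single (j, k)]
    · simp
    · rintro ⟨p, q⟩ hpq hne
      rw [if_neg, smul_zero]
      rintro ⟨-, rfl, rfl⟩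
      exact hne rfl
    · intro hmem
      exact (hmem (Finset.mem_antidiagonal.2 rfl)).elim
  · rw [if_neg h]
    refine Finset.sum_eq_zero fun p hp => ?_
    rw [if_neg, smul_zero]
    rintro ⟨hn, hp1, hp2⟩
    apply h
    rw [Finset.mem_antidiagonal] at hp
    exact ⟨hn, by rw [← hp, hp1, hp2]⟩

/-- Coefficients of `(X₀ + X₁)^n` in two variables: `[X₀^iX₁^j] = C(i+j, i)` if `n = i+j`, else `0`. (the coefficient extractions of Lazard's
`B_q`-computations). [cite: Lazard1955, §II Lemme 2] -/
theorem coeff_add_pow_fin_two (n i j : ℕ) :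
    coeff (single 0 i + single 1 j) (((X 0 : MvPowerSeries (Fin 2) B) + X 1) ^ n) =
      if n = i + j then ((i + j).choose i : B) else 0 := by
  rw [(Commute.all (X 0 : MvPowerSeries (Fin 2) B) (X 1)).add_pow', map_sum]
  simp_rw [map_nsmul, coeff_X_pow_mul_X_pow_fin_two]
  by_cases h : n = i + j
  · subst h
    rw [if_pos rfl, Finset.sum_eq_single (i, j)]
    · simp
    · rintro ⟨p, q⟩ hpq hne
      rw [if_neg, smul_zero]
      rintro ⟨rfl, rfl⟩
      exact hne rfl
    · intro hmem
      exact absurd (Finset.mem_antidiagonal.2 rfl : (i, j) ∈ Finset.antidiagonal (i + j)) hmem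
  · rw [if_neg h]
    refine Finset.sum_eq_zero fun p hp => ?_
    rw [if_neg, smul_zero]
    rintro ⟨hp1, hp2⟩
    apply h
    rw [Finset.mem_antidiagonal] at hp
    rw [← hp, hp1, hp2]

end Monomials

end Literature.RingTheory.FormalGroups
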